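import Summits.QuantumFields.QCD.Theses.SpectralDefectExtinction
import Literature.Barriers.QuantumFields.WilsonDeterminantSign
import Literature.MathematicalPhysics.QuantumFieldTheory.FermionFlow
import Literature.MathematicalPhysics.QuantumFieldTheory.SpectralDefectDensity
import Literature.MathematicalPhysics.QuantumFieldTheory.WilsonFlow
import Literature.MathematicalPhysics.QuantumLattice.OverlapLocality

/-!
# Sketch — crux-ideate r1, ideator 3 (gen 2) for `SpectralDefectExtinction.TipPricing` (stmt-QuantumFields-8967)

First lemmas of the idea card `schur-smooth-sector` (they only need to ELABORATE; `sorry` marks what the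
line proves first):

* `det_re_pos_of_accretive_of_conjHermitian` — a `J`-Hermitian (`Aᴴ = J A J`) accretive matrix has a real,
  positive determinant (eigenvalues have positive real part and come in conjugate pairs);
* `det_eq_uvDet_mul_schurDet` — Schur factorisation for complementary projections `P + Q = 1` with the
  `Q`-block invertible: `det D = det(QDQ + P) · det(PDP − PDQ(QDQ+P)⁻¹QDP + Q)`;
* `negCount_eq_negCount_add_negCount_schur` — Haynsworth inertia additivity in the same format;
* `uvBlock_wilsonDirac` — THE WILSON INSTANCE: if `q` projects onto colour fields on which Lüscher's
  covariant Laplacian has form `≥ E`, then for every bare mass `m > −E/2` the compression of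
  `D_W(U,m,1)` to `Ran(q ⊗ 1_spin)` is accretive with margin `E/2 + m`, its determinant is real and positive,
  and `Γ₅ ×` it has exactly half (`2·rank q`) negative eigenvalues — for EVERY `SU(3)` field `U`;
* `index_eq_index_schur_wilsonDirac` — consequently the spectral index of `Γ₅ D_W(U,m,1)` equals the
  index of `Γ₅ ×` the Schur complement on the low-Laplacian sector `Ran((1−q) ⊗ 1_spin)`;
* `realRoot_mem_chiralRayleigh` — a real eigenvalue of the massless operator lies between the Wilson
  (half-Dirichlet) Rayleigh quotients of the two chiral components of its eigenvector.
-/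

namespace Summit.QuantumFields.QCD.Cruxes.TipPricing.Ideator3g2

open Literature.MathematicalPhysics Literature.MathematicalPhysics.QuantumLattice
  Literature.MathematicalPhysics.QuantumFieldTheory Literature.Probability.LatticeModels
open Literature.Barriers.QuantumFields.WilsonDeterminant
open Matrix
open scoped Classical Kronecker

/-! ## Abstract linear algebra -/

/-- **Accretive + `J`-Hermitian ⇒ positive determinant.** If `J` is a Hermitian involution,
`Aᴴ = J A J` (so the characteristic polynomial of `A` has real coefficients: `A` is similar to `Aᴴ`) and
`Re⟨v, Av⟩ > 0` for all `v ≠ 0`, then every eigenvalue of `A` has positive real part, the non-real ones come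
in conjugate pairs, hence `det A` is real and positive. -/
theorem det_re_pos_of_accretive_of_conjHermitian :
    ∀ {n : Type} [Fintype n] [DecidableEq n] (A J : Matrix n n ℂ),
      J.IsHermitian → J * J = 1 → Aᴴ = J * A * J →
      (∀ v : n → ℂ, v ≠ 0 → 0 < (star v ⬝ᵥ A *ᵥ v).re) →
      0 < A.det.re ∧ A.det.im = 0 := by
  sorry

/-- **Schur factorisation for complementary projections.** For `P + Q = 1`, `P² = P`, `Q² = Q`, `PQ = QP = 0`
and the `Q`-block `QDQ + P` invertible:
`det D = det(QDQ + P) · det(PDP − PDQ (QDQ + P)⁻¹ QDP + Q)`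
(block form w.r.t. `Ran P ⊕ Ran Q`: `QDQ + P = 1_P ⊕ D_QQ`, and the second factor is `S ⊕ 1_Q` with
`S = D_PP − D_PQ D_QQ⁻¹ D_QP` the Schur complement). -/
theorem det_eq_uvDet_mul_schurDet :
    ∀ {n : Type} [Fintype n] [DecidableEq n] (D P Q : Matrix n n ℂ),
      P + Q = 1 → P * P = P → Q * Q = Q → P * Q = 0 → Q * P = 0 →
      IsUnit (Q * D * Q + P).det →
      D.det = (Q * D * Q + P).det * (P * D * P - P * D * Q * (Q * D * Q + P)⁻¹ * Q * D * P + Q).det := by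
  sorry

/-- **Haynsworth inertia additivity** in the same format: for Hermitian `H` and complementary ORTHOGONAL
projections `P, Q` with the `Q`-block invertible, the number of negative eigenvalues of `H` is that of the
`Q`-block plus that of the Schur complement on `Ran P`
(`QHQ + P` carries the `Q`-block and `+1` on `Ran P`; `PHP − PHQ(QHQ+P)⁻¹QHP + Q` carries the Schur complement
and `+1` on `Ran Q`; both are Hermitian). -/
theorem negCount_eq_negCount_add_negCount_schur :
    ∀ {n : Type} [Fintype n] [DecidableEq n] (H P Q : Matrix n n ℂ),
      H.IsHermitian → P.IsHermitian → Q.IsHermitian →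
      P + Q = 1 → P * P = P → Q * Q = Q →
      IsUnit (Q * H * Q + P).det →
      Multiset.countP (fun z : ℂ => z.re < 0) H.charpoly.roots =
        Multiset.countP (fun z : ℂ => z.re < 0) (Q * H * Q + P).charpoly.roots +
          Multiset.countP (fun z : ℂ => z.re < 0)
            (P * H * P - P * H * Q * (Q * H * Q + P)⁻¹ * Q * H * P + Q).charpoly.roots := by
  sorry

/-! ## The Wilson instance: the UV block of `D_W` on the high covariant-Laplacian sector -/

variable {L : ℕ} [NeZero L]

/-- A site ⊗ colour operator lifted to quark indices (trivial on spin): `q ⊗ 1₄`, reindexed along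
`(TorusSite × Fin 3) × Fin 4 ≃ TorusSite × (Fin 3 × Fin 4) = QuarkIdx`. -/
noncomputable def colourLift (q : Matrix (TorusSite 4 L × Fin 3) (TorusSite 4 L × Fin 3) ℂ) :
    Matrix (QuarkIdx L) (QuarkIdx L) ℂ :=
  Matrix.reindex (Equiv.prodAssoc _ _ _) (Equiv.prodAssoc _ _ _) (q ⊗ₖ (1 : Matrix (Fin 4) (Fin 4) ℂ))

/-- **The UV block is benign for every field.** Let `q` be an orthogonal projection on colour fields whose
range lies in the high sector of Lüscher's covariant Laplacian, `⟨φ, (−Δ_U) φ⟩ ≥ E‖φ‖²` for `qφ = φ`, and let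
`Q = q ⊗ 1_spin`. Then for every `SU(3)` field `U` and every bare mass `m > −E/2`:
(1) the compression `A := Q D_W(U,m,1) Q + (1 − Q)` is accretive with margin `min(E/2 + m, 1)`
    (Wilson positivity: `D_W + D_Wᴴ = (2m − Δ_U) ⊗ 1_spin` at `r = 1`);
(2) `det A` is real and positive (`A` is `Γ₅`-Hermitian since `Q` commutes with `Γ₅`);
(3) `Γ₅ (Q D_W Q) + (1 − Q)` is Hermitian with exactly `2 · rank q` negative eigenvalues
    (Lyapunov inertia on the `Γ₅`-balanced space `Ran Q = Ran q ⊗ ℂ⁴`, as in the disprover's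
    `negEigenvalueCount_eq_half`, which is the case `q = 1`, `m > 0`). -/
theorem uvBlock_wilsonDirac :
    ∀ (U : GaugeConfig 4 L SU3) (m E : ℝ) (q : Matrix (TorusSite 4 L × Fin 3) (TorusSite 4 L × Fin 3) ℂ),
      q.IsHermitian → q * q = q →
      (∀ φ : TorusSite 4 L × Fin 3 → ℂ, q *ᵥ φ = φ →
          E * (∑ i, ‖φ i‖ ^ 2) ≤ (star φ ⬝ᵥ ((-covariantLaplacian (fundamentalRep (Fin 3)) U) *ᵥ φ)).re) →
      -E / 2 < m →
      (∀ ψ : QuarkIdx L → ℂ,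
          min (E / 2 + m) 1 * (∑ i, ‖ψ i‖ ^ 2) ≤
            (star ψ ⬝ᵥ ((colourLift q * wilsonDirac (fundamentalRep (Fin 3)) U m 1 * colourLift q +
              (1 - colourLift q)) *ᵥ ψ)).re) ∧
      (0 < (colourLift q * wilsonDirac (fundamentalRep (Fin 3)) U m 1 * colourLift q +
              (1 - colourLift q)).det.re ∧
        (colourLift q * wilsonDirac (fundamentalRep (Fin 3)) U m 1 * colourLift q +
              (1 - colourLift q)).det.im = 0) ∧
      Multiset.countP (fun z : ℂ => z.re < 0)
          (spinorLift gammaFive * (colourLift q * wilsonDirac (fundamentalRep (Fin 3)) U m 1 * colourLift q) +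
            (1 - colourLift q)).charpoly.roots = 2 * q.rank := by
  sorry

/-- **The spectral index lives on the smooth sector.** With `q` as above, `p := 1 − q` (the LOW sector of
the covariant Laplacian, `P = p ⊗ 1_spin`), `A := Q D_W Q + P` and the Schur complement
`S := P D_W P − P D_W Q A⁻¹ Q D_W P` (as a full-space matrix, `+ Q` on the complementary block):
`n₋(Γ₅ D_W(U,m,1)) − 6L⁴ = n₋(Γ₅ S + Q) − 2·rank p` — the TIGHT integrand of `WindowExtinction` is the
index of an `N = 4·rank p`-dimensional `Γ₅`-Hermitian matrix, exactly, for every `U` and every `m > −E/2`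
(Haynsworth additivity + (3) of `uvBlock_wilsonDirac` + `12L⁴ = 4(rank q + rank p)`). Written additively in `ℕ`. -/
theorem index_eq_index_schur_wilsonDirac :
    ∀ (U : GaugeConfig 4 L SU3) (m E : ℝ) (q : Matrix (TorusSite 4 L × Fin 3) (TorusSite 4 L × Fin 3) ℂ),
      q.IsHermitian → q * q = q →
      (∀ φ : TorusSite 4 L × Fin 3 → ℂ, q *ᵥ φ = φ →
          E * (∑ i, ‖φ i‖ ^ 2) ≤ (star φ ⬝ᵥ ((-covariantLaplacian (fundamentalRep (Fin 3)) U) *ᵥ φ)).re) →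
      -E / 2 < m →
      Multiset.countP (fun z : ℂ => z.re < 0)
          (spinorLift gammaFive * wilsonDirac (fundamentalRep (Fin 3)) U m 1).charpoly.roots +
        2 * (1 - q).rank =
      Multiset.countP (fun z : ℂ => z.re < 0)
          (spinorLift gammaFive *
              (colourLift (1 - q) * wilsonDirac (fundamentalRep (Fin 3)) U m 1 * colourLift (1 - q) -
                colourLift (1 - q) * wilsonDirac (fundamentalRep (Fin 3)) U m 1 * colourLift q *
                  (colourLift q * wilsonDirac (fundamentalRep (Fin 3)) U m 1 * colourLift q +
                      colourLift (1 - q))⁻¹ *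
                  colourLift q * wilsonDirac (fundamentalRep (Fin 3)) U m 1 * colourLift (1 - q)) +
            colourLift q).charpoly.roots +
        6 * L ^ 4 := by
  sorry

/-- **Chiral Rayleigh sandwich** (exact, every field): if `D_W(U,0,1)ψ = λψ` with `λ` real and both chiral
components `ψ_± = ½(1 ± Γ₅)ψ` are non-zero, then `λ` lies between the Wilson Rayleigh quotients
`R_± = Re⟨ψ_±, D_W(U,0,1) ψ_±⟩/‖ψ_±‖² = ½·(covariant Dirichlet energy of ψ_±)/‖ψ_±‖²`
(the naive part is chirality-odd and anti-Hermitian, the Wilson part chirality-even: the two diagonal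
equations give `λ‖ψ_+‖² − Re⟨ψ_+,Dψ_+⟩ = −(λ‖ψ_-‖² − Re⟨ψ_-,Dψ_-⟩)`). A real mode below the dressed edge
therefore needs a CHIRAL colour field with sub-edge Dirichlet energy — the smooth-sector carrier. -/
theorem realRoot_mem_chiralRayleigh :
    ∀ (U : GaugeConfig 4 L SU3) (lam : ℝ) (ψ : QuarkIdx L → ℂ),
      wilsonDirac (fundamentalRep (Fin 3)) U 0 1 *ᵥ ψ = (lam : ℂ) • ψ →
      let ψp := spinorLift ((2 : ℂ)⁻¹ • (1 + gammaFive)) *ᵥ ψ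
      let ψm := spinorLift ((2 : ℂ)⁻¹ • (1 - gammaFive)) *ᵥ ψ
      ψp ≠ 0 → ψm ≠ 0 →
      min ((star ψp ⬝ᵥ wilsonDirac (fundamentalRep (Fin 3)) U 0 1 *ᵥ ψp).re / ∑ i, ‖ψp i‖ ^ 2)
          ((star ψm ⬝ᵥ wilsonDirac (fundamentalRep (Fin 3)) U 0 1 *ᵥ ψm).re / ∑ i, ‖ψm i‖ ^ 2) ≤ lam ∧
      lam ≤ max ((star ψp ⬝ᵥ wilsonDirac (fundamentalRep (Fin 3)) U 0 1 *ᵥ ψp).re / ∑ i, ‖ψp i‖ ^ 2)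
          ((star ψm ⬝ᵥ wilsonDirac (fundamentalRep (Fin 3)) U 0 1 *ᵥ ψm).re / ∑ i, ‖ψm i‖ ^ 2) := by
  sorry


/-! ## Card `flow-matched-index` — the Wilson flow as the smooth/rough separator inside the proof -/

section Flow

open MeasureTheory Filter Topology

/-- **Flowed admissibility clears the hole** (from the named fact `HJLLocality`, part 1): if every plaquette of
`V` is `ε`-admissible with `30ε < 1`, the massless Wilson operator `D_W(V,0,1)` has NO eigenvalue within
`√(1 − 30ε)` of the point `1` — in particular no REAL eigenvalue in `(1 − √(1−30ε), 1 + √(1−30ε)) ⊇ (15.1ε, 2 − 15.1ε)`: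
all real modes of an admissible field in the physical branch sit within `≈ 15ε` of the tip. Applied to
`V = wilsonFlow t U`, this is the deterministic half of the card. -/
theorem noRealRoot_of_admissible :
    HJLLocality (N := 3) (G := SU3) (fundamentalRep (Fin 3)) →
    ∀ (V : GaugeConfig 4 L SU3) (ε : ℝ), IsNormAdmissible (fundamentalRep (Fin 3)) V ε → 30 * ε < 1 →
      ∀ t : ℝ, |t - 1| < Real.sqrt (1 - 30 * ε) →
        (wilsonDirac (fundamentalRep (Fin 3)) V 0 1 - (t : ℂ) • (1 : Matrix (QuarkIdx L) (QuarkIdx L) ℂ)).det ≠ 0 := by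
  sorry

/-- **The flowed index is well defined**: under the same admissibility the negative-eigenvalue count of the
Hermitian Wilson operator `Γ₅ D_W(V,m,1)` is constant for `m` across the HJL gap around `m = -1` (no crossings
there), so `n₋(Γ₅ D_W(V,-1,1)) − 6L⁴` is a robust integer invariant of the admissible field `V`
("Q_flow"; for smooth fields it is the overlap index = Lüscher's geometric charge). -/
theorem negCount_eq_of_admissible :
    HJLLocality (N := 3) (G := SU3) (fundamentalRep (Fin 3)) →
    ∀ (V : GaugeConfig 4 L SU3) (ε : ℝ), IsNormAdmissible (fundamentalRep (Fin 3)) V ε → 30 * ε < 1 →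
      ∀ m m' : ℝ, |m + 1| < Real.sqrt (1 - 30 * ε) → |m' + 1| < Real.sqrt (1 - 30 * ε) →
        Multiset.countP (fun z : ℂ => z.re < 0)
            (spinorLift gammaFive * wilsonDirac (fundamentalRep (Fin 3)) V m 1).charpoly.roots =
          Multiset.countP (fun z : ℂ => z.re < 0)
            (spinorLift gammaFive * wilsonDirac (fundamentalRep (Fin 3)) V m' 1).charpoly.roots := by
  sorry

/-- The spectral index `n₋(Γ₅ D_W(U,μ,1)) − 6L⁴` as a real number (TIGHT's integrand without `|·|`). -/
noncomputable def wilsonIndex (L : ℕ) [NeZero L] (U : GaugeConfig 4 L SU3) (μ : ℝ) : ℝ :=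
  (Multiset.countP (fun z : ℂ => z.re < 0)
      (spinorLift gammaFive * wilsonDirac (fundamentalRep (Fin 3)) U μ 1).charpoly.roots : ℝ) - 6 * (L : ℝ) ^ 4

/-- The FLOWED index: the spectral index at the overlap point `m = -1` of the Wilson-flowed field at flow
time `t` (lattice units), `Q_flow := index(Γ₅ D_W(wilsonFlow t U, -1, 1))` — gluonic, with no sliver and no `M`. -/
noncomputable def flowIndex (L : ℕ) [NeZero L] (t : ℝ) (U : GaugeConfig 4 L SU3) : ℝ :=
  wilsonIndex L (wilsonFlow t U) (-1)

variable {Nf : ℕ}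

/-- The phase-quenched expectation on the scheme's own torus at step `k` (weights `∏_f |det D_W(U,m_f(k),1)|` at
the bare masses of the tuple `m`, Wilson measure at `β_k`) — the functional of the TIGHT clause of `WindowExtinction`. -/
noncomputable def pqExpect (reg : QCDRegularisation Nf) (m : Fin Nf → ℝ) (k : ℕ)
    (F : GaugeConfig 4 (2 * reg.L k + 1) SU3 → ℝ) : ℝ :=
  (∫ U, F U * ∏ f : Fin Nf, ‖fermionDet (wilsonDirac (fundamentalRep (Fin 3)) U
      (reg.mcrit k + reg.a k * m f / reg.Zm k) 1)‖
      ∂(wilsonMeasure (d := 4) (L := 2 * reg.L k + 1) (fundamentalRep (Fin 3)) (reg.β k))) /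
  (∫ U, ∏ f : Fin Nf, ‖fermionDet (wilsonDirac (fundamentalRep (Fin 3)) U
      (reg.mcrit k + reg.a k * m f / reg.Zm k) 1)‖
      ∂(wilsonMeasure (d := 4) (L := 2 * reg.L k + 1) (fundamentalRep (Fin 3)) (reg.β k)))

/-- **FLOW-MATCHED INDEX** (the card's Transfer, typed): along the witness, for every mass tuple above the
threshold and every `M > M₀`, the phase-quenched expected MISMATCH between the fermionic index just past the
line (bare mass `m_crit(k) − a_k M/Z_m(k)`) and the flowed index `Q_flow` tends to `0` — carriers smaller than
`√(8Cβ)` are flowed away AND cross far above the sliver, carriers larger than `ρ̂_w` are counted by both, and the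
mesoscopic mismatch is extinct with margin `(2π² − 1/(2b₀))β`. Unproved. `t : ℕ → ℝ` is the flow-time
schedule in lattice units (fixed `t₀`, or `t_k ≍ ρ̂_w(k)² → ∞` with `a_k² t_k → 0`). -/
def FlowMatchedIndex (reg : QCDRegularisation Nf) (M₀ : ℝ) (t : ℕ → ℝ) : Prop :=
  ∀ m : Fin Nf → ℝ, (∀ f, M₀ < m f) → ∀ M : ℝ, M₀ < M →
    Tendsto (fun k => pqExpect reg m k (fun U =>
      |wilsonIndex (2 * reg.L k + 1) U (reg.mcrit k - reg.a k * M / reg.Zm k) -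
        flowIndex (2 * reg.L k + 1) (t k) U|)) atTop (𝓝 0)

/-- **GLUONIC TIGHT**: the flowed charge fluctuates — `E₊|Q_flow| ≥ 1 + η` eventually on the scheme torus. Note
that it does not mention `M`: the sliver `[line, line + a_kM/Z_k)` has disappeared. (χ_t-type; unproved.) -/
def GluonicTight (reg : QCDRegularisation Nf) (M₀ : ℝ) (t : ℕ → ℝ) (η : ℝ) : Prop :=
  ∀ m : Fin Nf → ℝ, (∀ f, M₀ < m f) →
    ∀ᶠ k : ℕ in atTop, 1 + η ≤ pqExpect reg m k (fun U => |flowIndex (2 * reg.L k + 1) (t k) U|)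

/-- **TIGHT from the flowed charge**: `E₊|index| ≥ E₊|Q_flow| − E₊|index − Q_flow|`, so flow-matching plus
gluonic TIGHT give the TIGHT conjunct of `WindowExtinction` in its own functional (`pqExpect` unfolds to it
verbatim). Needs only linearity/monotonicity of the ratio of integrals (and measurability of the root counts,
Disproof §5(4)). -/
theorem tight_of_flowMatched (reg : QCDRegularisation Nf) (M₀ : ℝ) (t : ℕ → ℝ) (η : ℝ) (hη : 0 < η)
    (hmatch : FlowMatchedIndex reg M₀ t) (hglue : GluonicTight reg M₀ t η) :
    ∀ m : Fin Nf → ℝ, (∀ f, M₀ < m f) → ∀ M : ℝ, M₀ < M →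
      ∀ᶠ k : ℕ in atTop, 1 ≤ pqExpect reg m k (fun U =>
        |wilsonIndex (2 * reg.L k + 1) U (reg.mcrit k - reg.a k * M / reg.Zm k)|) := by
  sorry

end Flow

end Summit.QuantumFields.QCD.Cruxes.TipPricing.Ideator3g2
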